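import Literature.Analysis.FluidPDE.Vorticity
import Literature.Analysis.FluidPDE.VectorCalculusProofs
import Literature.Analysis.FluidPDE.BiotSavartHolderCurl
import HarnessLib

/-!
# Vorticity: discharges of `div ω = 0`

Sibling of `Vorticity.lean` (named facts `Literature.Analysis.FluidPDE.divergence_vorticity`: the
vorticity `ω(t) = curl u(t)` of a `C²` velocity field is divergence free; and
`Literature.Analysis.FluidPDE.IsVorticitySolutionOn.isDivFree_vorticity`: the vorticity of a classical
solution of the vorticity formulation is divergence free at every time of the time set). Kept in a
leaf file so that the definitions file `Vorticity.lean` (seven direct importers) is not rewritten and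
does not acquire the import `VectorCalculusProofs`.

Source. Majda–Bertozzi use `div ω = 0` for `ω = curl v` as a standard vector identity, without
proof: §1.7, proof of Prop. 1.12, p. 26 ("Because `div v = 0` and `ω = curl v`, we have
`div ω ≡ 0`" in the vorticity-flux step (1.65), and "the compatibility condition `div ω = 0`" in
the helicity step (1.67)), and §2.3.2 (3D Beltrami flows, after Def. 2.1 / eq. (2.38): "Because
`ω = curl v`, the vorticity satisfies the compatibility condition `div ω = 0`"). The identity itself
(symmetry of second derivatives of a `C²` field) is the in-tree discharge
`Literature.Analysis.FluidPDE.divergence_curl_eq_zero_holds` (`VectorCalculusProofs.lean`); the two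
facts below are its specialisations to `vorticity u t = curl (u t)` (by `rfl`), the second one
through the smoothness of the time slices of a vorticity solution
(`IsVorticitySolutionOn.contDiff_velocity`, `C^∞ ⇒ C²`).

* `Literature.Analysis.FluidPDE.divergence_vorticity_holds : divergence_vorticity`.
* `Literature.Analysis.FluidPDE.IsVorticitySolutionOn.isDivFree_vorticity_holds :
    IsVorticitySolutionOn.isDivFree_vorticity`.
* `Literature.Analysis.FluidPDE.curl_biotSavart_holds : curl_biotSavart` (see the next section).

## Discharge of `curl_biotSavart` (Majda–Bertozzi Prop. 2.16 (ii))

The third fact discharged here is `Literature.Analysis.FluidPDE.curl_biotSavart` (`Vorticity.lean`):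
for a `C¹` divergence-free vorticity `ω` with `ω ∈ L¹ ∩ L^∞`, `Dω ∈ L¹ ∩ L^∞`, the Biot–Savart
velocity `v = K₃ ∗ ω = biotSavart ω` satisfies **`curl v = ω`** — Majda–Bertozzi, *Vorticity and
Incompressible Flow*, §2.4.1 Prop. 2.16 (ii) (p. 71–72 of the book, p. 63–64 of the held text:
"if `div ω = 0`, then … `ω = curl (−curl ψ)`", `v = −curl ψ = K₃ ∗ ω`, proof through the vector
identities (2.96)–(2.97)). The printed proof is for smooth rapidly decaying `ω`; the tree already
carries the argument at low regularity:

* `curl_biotSavart_eq_of_isWeaklyDivFree` (`BiotSavartHolderCurl.lean`): `curl (K₃ ∗ ω) = ω` for a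
  continuous, weakly divergence-free `ω ∈ L¹ ∩ L^∞` **provided `K₃ ∗ ω ∈ C¹`** (weak identity
  against curl-type test fields from the Newtonian-potential representation (2.92)–(2.94), then
  du Bois-Reymond);
* `VectorCalculus.IsDivFree.isWeaklyDivFree_holds` (`VectorCalculus.lean`): pointwise `div ω = 0`
  for a `C¹` field gives the weak form.

What this file adds is the remaining regularity input, **`K₃ ∗ ω ∈ C¹` for a `C¹` density with
`ω ∈ L¹ ∩ L^∞` and `Dω ∈ L^∞`** (`contDiff_one_biotSavart_of_contDiff`), proved for every singular
kernel of the class `IsC1SingularKernel` (`SingularKernelTruncation.lean`; Majda–Bertozzi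
(4.30)–(4.31)) as `contDiff_one_singularPotential_of_contDiff`, by the smooth near/far splitting of
Gilbarg–Trudinger §4.1 (proof of Lemma 4.1) already used in the tree: with the radial cutoff
`θ = radialCutoff 1 2`,
`∫ K(x − y) f(y) dy = ∫ θ(z) K(z) f(x − z) dz + ∫ K₁(x − y) f(y) dy`, `K₁ = (1 − θ)K = truncKernel K 1`
(`singularPotential_eq_near_add_truncPotential`). The near part is differentiated on the density
(`hasFDerivAt_integral_radialCutoff_smul_kernel`: dominated differentiation, the `x`-derivative
`θ(z) K(z) ∘ Df(x − z)` being bounded by `A ‖Df‖_∞ 1_{|z|<2}|z|⁻²`), the far part on the kernel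
(`hasFDerivAt_truncPotential_of_integrable`: `∇K₁` is bounded and `f ∈ L¹`; the tree's
`hasFDerivAt_truncPotential` asks compact support instead), and both derivatives are continuous by
dominated convergence. The hypothesis `Dω ∈ L¹` of the fact is not needed.

## References

* A. J. Majda, A. L. Bertozzi, *Vorticity and Incompressible Flow*, Cambridge Texts in Applied
  Mathematics 27 (CUP 2002), doi:10.1017/cbo9780511613203 (`MajdaBertozziCUP2002`): §1.7, proof
  of Prop. 1.12, p. 26 (conservation of vorticity flux (1.65) and helicity (1.67): `div ω ≡ 0` for
  `ω = curl v`); §2.3.2, Def. 2.1, eq. (2.38)–(2.39) (Beltrami flows: "the vorticity satisfies the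
  compatibility condition `div ω = 0`"); §2.4.1 Prop. 2.16 (ii) and its proof, (2.90)–(2.97), p. 71–72
  (p. 63–64 of the held text): `curl (K₃ ∗ ω) = ω` for `v = K₃ ∗ ω`, `div ω = 0`.
* D. Gilbarg, N. S. Trudinger, *Elliptic Partial Differential Equations of Second Order*
  (Springer 2001), §4.1, proof of Lemma 4.1 (regularised potentials `w_ε → w`, `Dw_ε → Dw`;
  differentiation of `∫ Γ(x − y) f(y) dy`). [GilbargTrudinger2001]
-/

noncomputable section

namespace Literature.Analysis.FluidPDE

/-! ### Discharge: `div (vorticity u t) = 0` for `C²` slices -/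

/-- **Discharge** of `divergence_vorticity`: the vorticity `ω(t) = curl u(t)` of a velocity field
whose time slice `u t` is `C²` is divergence free, `div ω(t) = 0` pointwise — the "compatibility
condition `div ω = 0`" that Majda–Bertozzi use without proof (§1.7, proof of Prop. 1.12, p. 26;
§2.3.2). Proof: `vorticity u t = curl (u t)` definitionally, and `div (curl v) = 0` for `C²` fields
is `divergence_curl_eq_zero_holds` (symmetry of second derivatives).
[cite: MajdaBertozziCUP2002, §1.7 proof of Prop. 1.12, p. 26 ("ω = curl v ⇒ div ω ≡ 0"); §2.3.2 eq. (2.38)–(2.39)] -/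
theorem divergence_vorticity_holds : divergence_vorticity := by
  intro u t hu x
  exact divergence_curl_eq_zero_holds (u t) hu x

/-! ### Discharge: the vorticity of a vorticity solution is divergence free -/

section VorticityFormulation

variable {S : Set ℝ} {ν : ℝ} {u : ℝ → EuclideanSpace ℝ (Fin 3) → EuclideanSpace ℝ (Fin 3)}

/-- **Discharge** of `IsVorticitySolutionOn.isDivFree_vorticity`: for a classical solution `u` of
the vorticity formulation on the time set `S`, `div (vorticity u t) = 0` on `ℝ³` for every `t ∈ S`
(Majda–Bertozzi, §1.7, proof of Prop. 1.12, p. 26: "Because `div v = 0` and `ω = curl v`, we have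
`div ω ≡ 0`"; only `ω = curl v` is actually needed). Proof: the time slice `u t` is `C^∞`
(`IsVorticitySolutionOn.contDiff_velocity`), hence `C²`, and `divergence_vorticity_holds` applies.
[cite: MajdaBertozziCUP2002, §1.7 proof of Prop. 1.12, p. 26 ("ω = curl v ⇒ div ω ≡ 0"); §2.3.2 eq. (2.38)–(2.39)] -/
theorem IsVorticitySolutionOn.isDivFree_vorticity_holds :
    IsVorticitySolutionOn.isDivFree_vorticity (S := S) (ν := ν) (u := u) := by
  intro h t ht x
  exact divergence_vorticity_holds u t (contDiff_infty.1 (h.contDiff_velocity ht) 2) x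

end VorticityFormulation

/-! ### `C¹` regularity of singular potentials of `C¹` densities in `L¹ ∩ L^∞` -/

section SingularPotentialC1

open MeasureTheory Set Function Filter Metric Topology

variable {V W : Type*} [NormedAddCommGroup V] [NormedSpace ℝ V] [NormedAddCommGroup W]
  [NormedSpace ℝ W]

/-- **The singular integrand is integrable for a continuous density in `L¹ ∩ L^∞`** (no compact
support): for a kernel of the class `IsC1SingularKernel K A` and `f` continuous, integrable and
bounded by `M`, `y ↦ K(x − y) f(y)` is dominated by `A M 1_{|x−y|<1}|x − y|⁻² + A ‖f y‖`
(Majda–Bertozzi, §2.4.1: `|K₃(x)| ≤ c|x|⁻²` is locally integrable and bounded away from the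
origin; the tree's `integrable_kernel_sub_apply` is the compactly supported case). [folklore] -/
theorem integrable_kernel_sub_apply_of_integrable
    {K : EuclideanSpace ℝ (Fin 3) → V →L[ℝ] W} {A : ℝ} (hK : IsC1SingularKernel K A)
    {f : EuclideanSpace ℝ (Fin 3) → V} (hf : Continuous f) (hfi : Integrable f)
    {M : ℝ} (hM : ∀ y, ‖f y‖ ≤ M) (x : EuclideanSpace ℝ (Fin 3)) :
    Integrable (fun y => K (x - y) (f y)) := by
  have hA := hK.nonneg
  have hM0 : 0 ≤ M := (norm_nonneg _).trans (hM x)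
  have hb : Integrable (fun y => A * M * kernelMajorant 1 (x - y) + A * ‖f y‖) :=
    (((integrable_kernelMajorant 1).comp_sub_left x).const_mul (A * M)).add (hfi.norm.const_mul A)
  refine hb.mono' (aestronglyMeasurable_kernel_sub_apply hK hf x)
    (Eventually.of_forall fun y => ?_)
  have h1 : ‖K (x - y) (f y)‖ ≤ A * (‖x - y‖ ^ 2)⁻¹ * ‖f y‖ :=
    (ContinuousLinearMap.le_opNorm _ _).trans
      (mul_le_mul_of_nonneg_right (hK.norm_le _) (norm_nonneg _))
  have hk0 : 0 ≤ kernelMajorant 1 (x - y) := kernelMajorant_nonneg _ _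
  by_cases hxy : ‖x - y‖ < 1
  · have hmaj : kernelMajorant 1 (x - y) = (‖x - y‖ ^ 2)⁻¹ := by
      simp [kernelMajorant, indicator, hxy]
    calc ‖K (x - y) (f y)‖ ≤ A * (‖x - y‖ ^ 2)⁻¹ * ‖f y‖ := h1
      _ ≤ A * (‖x - y‖ ^ 2)⁻¹ * M := by
          gcongr
          exact hM y
      _ = A * M * kernelMajorant 1 (x - y) := by
          rw [hmaj]
          ring
      _ ≤ A * M * kernelMajorant 1 (x - y) + A * ‖f y‖ :=
          le_add_of_nonneg_right (mul_nonneg hA (norm_nonneg _))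
  · have hge : 1 ≤ ‖x - y‖ := not_lt.1 hxy
    have hinv : (‖x - y‖ ^ 2)⁻¹ ≤ 1 := inv_le_one_of_one_le₀ (one_le_pow₀ hge)
    calc ‖K (x - y) (f y)‖ ≤ A * (‖x - y‖ ^ 2)⁻¹ * ‖f y‖ := h1
      _ ≤ A * 1 * ‖f y‖ := by gcongr
      _ = A * ‖f y‖ := by rw [mul_one]
      _ ≤ A * M * kernelMajorant 1 (x - y) + A * ‖f y‖ :=
          le_add_of_nonneg_left (mul_nonneg (mul_nonneg hA hM0) hk0)

/-- **Near/far splitting of a singular potential** at scale `ε > 0` for a continuous density in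
`L¹ ∩ L^∞`: with the radial cutoff `θ_ε = radialCutoff ε (2ε)` (`= 1` on `|z| ≤ ε`, `= 0` on
`|z| ≥ 2ε`) and the truncated kernel `K_ε = (1 − θ_ε)K` (`truncKernel`),
`∫ K(x − y) f(y) dy = ∫ θ_ε(z) K(z) f(x − z) dz + ∫ K_ε(x − y) f(y) dy`
(Gilbarg–Trudinger §4.1, proof of Lemma 4.1: `w = (w − w_ε) + w_ε`). [folklore] -/
theorem singularPotential_eq_near_add_truncPotential
    {K : EuclideanSpace ℝ (Fin 3) → V →L[ℝ] W} {A : ℝ} (hK : IsC1SingularKernel K A)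
    {ε : ℝ} (hε : 0 < ε) {f : EuclideanSpace ℝ (Fin 3) → V} (hf : Continuous f)
    (hfi : Integrable f) {M : ℝ} (hM : ∀ y, ‖f y‖ ≤ M) (x : EuclideanSpace ℝ (Fin 3)) :
    singularPotential K f x =
      (∫ z, radialCutoff ε (2 * ε) z • K z (f (x - z))) + truncPotential K ε f x := by
  have hI := integrable_kernel_sub_apply_of_integrable hK hf hfi hM x
  have hθc : Continuous (radialCutoff ε (2 * ε) : EuclideanSpace ℝ (Fin 3) → ℝ) :=
    (radialCutoff_contDiff (n := 0) ε (2 * ε)).continuous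
  have i1 : Integrable fun y => radialCutoff ε (2 * ε) (x - y) • K (x - y) (f y) := by
    refine hI.norm.mono'
      ((hθc.comp (continuous_const.sub continuous_id)).aestronglyMeasurable.smul
        (aestronglyMeasurable_kernel_sub_apply hK hf x)) (Eventually.of_forall fun y => ?_)
    rw [norm_smul, Real.norm_eq_abs]
    exact mul_le_of_le_one_left (norm_nonneg _) (abs_radialCutoff_le_one _ _ _)
  have i2 : Integrable fun y => truncKernel K ε (x - y) (f y) := by
    refine hI.norm.mono' (continuous_truncKernel_sub_apply hK hε hf x).aestronglyMeasurable
      (Eventually.of_forall fun y => ?_)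
    rw [truncKernel, smul_apply, norm_smul, Real.norm_eq_abs]
    refine mul_le_of_le_one_left (norm_nonneg _) ?_
    rw [abs_le]
    constructor <;>
      linarith [radialCutoff_nonneg ε (2 * ε) (x - y), radialCutoff_le_one ε (2 * ε) (x - y)]
  have hsplit : singularPotential K f x =
      (∫ y, radialCutoff ε (2 * ε) (x - y) • K (x - y) (f y)) + truncPotential K ε f x := by
    rw [singularPotential, truncPotential, ← integral_add i1 i2]
    refine integral_congr_ae (Eventually.of_forall fun y => ?_)
    simp only [truncKernel, smul_apply]
    rw [← add_smul, add_sub_cancel, one_smul]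
  rw [hsplit]
  congr 1
  have h := integral_sub_left_eq_self
    (fun z => radialCutoff ε (2 * ε) z • K z (f (x - z))) volume x
  simp only [sub_sub_cancel] at h
  exact h

/-- **Size of the cut-off kernel near the origin**: `‖θ_ε(z) K(z)‖ ≤ A 1_{|z|<2ε} |z|⁻²` in
operator norm (the factor `θ_ε` vanishes off the ball of radius `2ε`, and `‖K(z)‖ ≤ A|z|⁻²`). [folklore] -/
theorem norm_radialCutoff_smul_kernel_le
    {K : EuclideanSpace ℝ (Fin 3) → V →L[ℝ] W} {A : ℝ} (hK : IsC1SingularKernel K A)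
    {ε : ℝ} (hε : 0 < ε) (z : EuclideanSpace ℝ (Fin 3)) :
    ‖radialCutoff ε (2 * ε) z • K z‖ ≤ A * kernelMajorant (2 * ε) z := by
  have hA := hK.nonneg
  by_cases hz : 2 * ε ≤ ‖z‖
  · rw [radialCutoff_eq_zero hε.le (by linarith) hz, zero_smul, norm_zero]
    exact mul_nonneg hA (kernelMajorant_nonneg _ _)
  · have hlt : ‖z‖ < 2 * ε := not_le.1 hz
    have hmaj : kernelMajorant (2 * ε) z = (‖z‖ ^ 2)⁻¹ := by
      simp [kernelMajorant, indicator, hlt]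
    rw [hmaj, norm_smul, Real.norm_eq_abs]
    calc |radialCutoff ε (2 * ε) z| * ‖K z‖ ≤ 1 * (A * (‖z‖ ^ 2)⁻¹) := by
          gcongr
          · exact abs_radialCutoff_le_one _ _ _
          · exact hK.norm_le z
      _ = A * (‖z‖ ^ 2)⁻¹ := one_mul _

/-- The near integrand `z ↦ θ_ε(z) K(z) f(x − z)` is a.e. strongly measurable (continuous off
the origin) for continuous `f`. [folklore] -/
theorem aestronglyMeasurable_radialCutoff_smul_kernel_apply
    {K : EuclideanSpace ℝ (Fin 3) → V →L[ℝ] W} {A : ℝ} (hK : IsC1SingularKernel K A) (ε : ℝ)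
    {f : EuclideanSpace ℝ (Fin 3) → V} (hf : Continuous f) (x : EuclideanSpace ℝ (Fin 3)) :
    AEStronglyMeasurable (fun z => radialCutoff ε (2 * ε) z • K z (f (x - z))) volume := by
  have hθc : Continuous (radialCutoff ε (2 * ε) : EuclideanSpace ℝ (Fin 3) → ℝ) :=
    (radialCutoff_contDiff (n := 0) ε (2 * ε)).continuous
  have hcont : ContinuousOn (fun z => radialCutoff ε (2 * ε) z • K z (f (x - z))) {0}ᶜ :=
    hθc.continuousOn.smul
      (hK.continuousOn.clm_apply (hf.comp (continuous_const.sub continuous_id)).continuousOn)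
  have h := hcont.aestronglyMeasurable (μ := volume) (measurableSet_singleton 0).compl
  rwa [restrict_compl_singleton] at h

/-- The `x`-derivative `z ↦ θ_ε(z) K(z) ∘ G(x − z)` of the near integrand is a.e. strongly
measurable (continuous off the origin) for a continuous operator field `G` (`G = Df`). [folklore] -/
theorem aestronglyMeasurable_radialCutoff_smul_kernel_comp
    {K : EuclideanSpace ℝ (Fin 3) → V →L[ℝ] W} {A : ℝ} (hK : IsC1SingularKernel K A) (ε : ℝ)
    {G : EuclideanSpace ℝ (Fin 3) → EuclideanSpace ℝ (Fin 3) →L[ℝ] V} (hG : Continuous G)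
    (x : EuclideanSpace ℝ (Fin 3)) :
    AEStronglyMeasurable (fun z => radialCutoff ε (2 * ε) z • (K z).comp (G (x - z))) volume := by
  have hθc : Continuous (radialCutoff ε (2 * ε) : EuclideanSpace ℝ (Fin 3) → ℝ) :=
    (radialCutoff_contDiff (n := 0) ε (2 * ε)).continuous
  have hcont :
      ContinuousOn (fun z => radialCutoff ε (2 * ε) z • (K z).comp (G (x - z))) {0}ᶜ :=
    hθc.continuousOn.smul
      (hK.continuousOn.clm_comp (hG.comp (continuous_const.sub continuous_id)).continuousOn)
  have h := hcont.aestronglyMeasurable (μ := volume) (measurableSet_singleton 0).compl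
  rwa [restrict_compl_singleton] at h

/-- **Domination of the `x`-derivative of the near integrand**: for `‖G(·)‖ ≤ M'`,
`‖θ_ε(z) K(z) ∘ G(x − z)‖ ≤ A M' 1_{|z|<2ε}|z|⁻²`, an integrable majorant independent of `x`. [folklore] -/
theorem norm_radialCutoff_smul_kernel_comp_le
    {K : EuclideanSpace ℝ (Fin 3) → V →L[ℝ] W} {A : ℝ} (hK : IsC1SingularKernel K A)
    {ε : ℝ} (hε : 0 < ε) {G : EuclideanSpace ℝ (Fin 3) → EuclideanSpace ℝ (Fin 3) →L[ℝ] V}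
    {M' : ℝ} (hM' : ∀ y, ‖G y‖ ≤ M') (x z : EuclideanSpace ℝ (Fin 3)) :
    ‖radialCutoff ε (2 * ε) z • (K z).comp (G (x - z))‖ ≤ A * M' * kernelMajorant (2 * ε) z := by
  have hA := hK.nonneg
  calc ‖radialCutoff ε (2 * ε) z • (K z).comp (G (x - z))‖
      = ‖(radialCutoff ε (2 * ε) z • K z).comp (G (x - z))‖ := by
        rw [ContinuousLinearMap.smul_comp]
    _ ≤ ‖radialCutoff ε (2 * ε) z • K z‖ * ‖G (x - z)‖ :=
        ContinuousLinearMap.opNorm_comp_le _ _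
    _ ≤ A * kernelMajorant (2 * ε) z * M' :=
        mul_le_mul (norm_radialCutoff_smul_kernel_le hK hε z) (hM' _) (norm_nonneg _)
          (mul_nonneg hA (kernelMajorant_nonneg _ _))
    _ = A * M' * kernelMajorant (2 * ε) z := by ring

/-- **The near part is differentiable, with the derivative on the density**: for `f ∈ C¹` bounded
with bounded derivative,
`∇ₓ ∫ θ_ε(z) K(z) f(x − z) dz = ∫ θ_ε(z) K(z) ∘ Df(x − z) dz`
(dominated differentiation under the integral: the `x`-derivative of the integrand is bounded by
`A ‖Df‖_∞ 1_{|z|<2ε}|z|⁻²`; Gilbarg–Trudinger §4.1, the term `w − w_ε = ∫ Γ η_ε f`). [folklore] -/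
theorem hasFDerivAt_integral_radialCutoff_smul_kernel
    {K : EuclideanSpace ℝ (Fin 3) → V →L[ℝ] W} {A : ℝ} (hK : IsC1SingularKernel K A)
    {ε : ℝ} (hε : 0 < ε) {f : EuclideanSpace ℝ (Fin 3) → V} (hf : ContDiff ℝ 1 f)
    {M M' : ℝ} (hM : ∀ y, ‖f y‖ ≤ M) (hM' : ∀ y, ‖fderiv ℝ f y‖ ≤ M')
    (x₀ : EuclideanSpace ℝ (Fin 3)) :
    HasFDerivAt (fun x => ∫ z, radialCutoff ε (2 * ε) z • K z (f (x - z)))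
      (∫ z, radialCutoff ε (2 * ε) z • (K z).comp (fderiv ℝ f (x₀ - z))) x₀ := by
  have hA := hK.nonneg
  have hfc : Continuous f := hf.continuous
  have hDfc : Continuous (fderiv ℝ f) := hf.continuous_fderiv one_ne_zero
  -- integrability of the near integrand at `x₀`
  have hint : Integrable (fun z => radialCutoff ε (2 * ε) z • K z (f (x₀ - z))) := by
    refine ((integrable_kernelMajorant (2 * ε)).const_mul (A * M)).mono'
      (aestronglyMeasurable_radialCutoff_smul_kernel_apply hK ε hfc x₀)
      (Eventually.of_forall fun z => ?_)
    calc ‖radialCutoff ε (2 * ε) z • K z (f (x₀ - z))‖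
        = ‖(radialCutoff ε (2 * ε) z • K z) (f (x₀ - z))‖ := by rw [smul_apply]
      _ ≤ ‖radialCutoff ε (2 * ε) z • K z‖ * ‖f (x₀ - z)‖ :=
          ContinuousLinearMap.le_opNorm _ _
      _ ≤ A * kernelMajorant (2 * ε) z * M :=
          mul_le_mul (norm_radialCutoff_smul_kernel_le hK hε z) (hM _) (norm_nonneg _)
            (mul_nonneg hA (kernelMajorant_nonneg _ _))
      _ = A * M * kernelMajorant (2 * ε) z := by ring
  refine hasFDerivAt_integral_of_dominated_of_fderiv_le (𝕜 := ℝ) (μ := volume) (s := univ)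
    (F := fun x z => radialCutoff ε (2 * ε) z • K z (f (x - z)))
    (F' := fun x z => radialCutoff ε (2 * ε) z • (K z).comp (fderiv ℝ f (x - z)))
    (bound := fun z => A * M' * kernelMajorant (2 * ε) z) univ_mem ?_ hint ?_ ?_ ?_ ?_
  · exact Eventually.of_forall fun x =>
      aestronglyMeasurable_radialCutoff_smul_kernel_apply hK ε hfc x
  · exact aestronglyMeasurable_radialCutoff_smul_kernel_comp hK ε hDfc x₀
  · exact Eventually.of_forall fun z x _ => norm_radialCutoff_smul_kernel_comp_le hK hε hM' x z
  · exact (integrable_kernelMajorant (2 * ε)).const_mul (A * M')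
  · refine Eventually.of_forall fun z x _ => ?_
    have hD : HasFDerivAt f (fderiv ℝ f (x - z)) (x - z) :=
      ((hf.differentiable one_ne_zero) _).hasFDerivAt
    have h1 : HasFDerivAt (fun x : EuclideanSpace ℝ (Fin 3) => f (x - z))
        (fderiv ℝ f (x - z)) x := by
      have h := hD.comp x ((hasFDerivAt_id x).sub_const z)
      rw [ContinuousLinearMap.comp_id] at h
      exact h
    exact ((K z).hasFDerivAt.comp x h1).const_smul (radialCutoff ε (2 * ε) z)

/-- **The derivative of the near part is continuous** in `x` (dominated convergence with the
same majorant `A ‖G‖_∞ 1_{|z|<2ε}|z|⁻²`, the operator field `G = Df` being continuous). [folklore] -/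
theorem continuous_integral_radialCutoff_smul_kernel_comp
    {K : EuclideanSpace ℝ (Fin 3) → V →L[ℝ] W} {A : ℝ} (hK : IsC1SingularKernel K A)
    {ε : ℝ} (hε : 0 < ε) {G : EuclideanSpace ℝ (Fin 3) → EuclideanSpace ℝ (Fin 3) →L[ℝ] V}
    (hG : Continuous G) {M' : ℝ} (hM' : ∀ y, ‖G y‖ ≤ M') :
    Continuous fun x => ∫ z, radialCutoff ε (2 * ε) z • (K z).comp (G (x - z)) := by
  refine continuous_of_dominated (bound := fun z => A * M' * kernelMajorant (2 * ε) z)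
    (fun x => aestronglyMeasurable_radialCutoff_smul_kernel_comp hK ε hG x)
    (fun x => Eventually.of_forall fun z => norm_radialCutoff_smul_kernel_comp_le hK hε hM' x z)
    ((integrable_kernelMajorant (2 * ε)).const_mul (A * M')) (Eventually.of_forall fun z => ?_)
  exact ((continuous_const (y := K z)).clm_comp
    (hG.comp (continuous_id.sub continuous_const))).const_smul (radialCutoff ε (2 * ε) z)

/-- The `x`-derivative `y ↦ (∇K_ε(x − y) ·)(f y)` of the far integrand is continuous in `y`
(for the continuity in `x` see `continuous_integral_fderiv_truncKernel_flip`). [folklore] -/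
theorem continuous_fderiv_truncKernel_sub_flip_apply
    {K : EuclideanSpace ℝ (Fin 3) → V →L[ℝ] W} {A : ℝ} (hK : IsC1SingularKernel K A)
    {ε : ℝ} (hε : 0 < ε) {f : EuclideanSpace ℝ (Fin 3) → V} (hf : Continuous f)
    (x : EuclideanSpace ℝ (Fin 3)) :
    Continuous fun y => (fderiv ℝ (truncKernel K ε) (x - y)).flip (f y) := by
  have hDc : Continuous (fderiv ℝ (truncKernel K ε)) :=
    (contDiff_truncKernel hK hε).continuous_fderiv one_ne_zero
  have h1 : Continuous fun y => (fderiv ℝ (truncKernel K ε) (x - y)).flip :=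
    (ContinuousLinearMap.flipₗᵢ ℝ (EuclideanSpace ℝ (Fin 3)) V W).continuous.comp
      (hDc.comp (continuous_const.sub continuous_id))
  exact h1.clm_apply hf

/-- **The far part is differentiable, with the derivative on the kernel**, for a continuous
density in `L¹` (no compact support):
`∇(truncPotential K ε f)(x) = ∫ (∇K_ε(x − y) ·)(f y) dy` (dominated differentiation:
`‖∇K_ε‖ ≤ A(1 + 2B) ε⁻³` and `f ∈ L¹`; the tree's `hasFDerivAt_truncPotential` is the compactly
supported case; Gilbarg–Trudinger §4.1, proof of Lemma 4.1, `w_ε ∈ C¹`). [folklore] -/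
theorem hasFDerivAt_truncPotential_of_integrable
    {K : EuclideanSpace ℝ (Fin 3) → V →L[ℝ] W} {A : ℝ} (hK : IsC1SingularKernel K A)
    {ε : ℝ} (hε : 0 < ε) {f : EuclideanSpace ℝ (Fin 3) → V} (hf : Continuous f)
    (hfi : Integrable f) (x₀ : EuclideanSpace ℝ (Fin 3)) :
    HasFDerivAt (truncPotential K ε f)
      (∫ y, (fderiv ℝ (truncKernel K ε) (x₀ - y)).flip (f y)) x₀ := by
  obtain ⟨B, hB0, hB⟩ := exists_norm_fderiv_radialCutoff_le
  set C : ℝ := A * (1 + 2 * B) * (ε ^ 3)⁻¹ with hC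
  have hcont : ContDiff ℝ 1 (truncKernel K ε) := contDiff_truncKernel hK hε
  unfold truncPotential
  refine hasFDerivAt_integral_of_dominated_of_fderiv_le (𝕜 := ℝ) (μ := volume) (s := univ)
    (F := fun x y => truncKernel K ε (x - y) (f y))
    (F' := fun x y => (fderiv ℝ (truncKernel K ε) (x - y)).flip (f y))
    (bound := fun y => C * ‖f y‖) univ_mem ?_ ?_ ?_ ?_ ?_ ?_
  · exact Eventually.of_forall fun x =>
      (continuous_truncKernel_sub_apply hK hε hf x).aestronglyMeasurable
  · refine (hfi.norm.const_mul (A * (ε ^ 2)⁻¹)).mono'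
      (continuous_truncKernel_sub_apply hK hε hf x₀).aestronglyMeasurable
      (Eventually.of_forall fun y => ?_)
    exact (ContinuousLinearMap.le_opNorm _ _).trans
      (mul_le_mul_of_nonneg_right (norm_truncKernel_le_const hK hε (x₀ - y)) (norm_nonneg _))
  · exact (continuous_fderiv_truncKernel_sub_flip_apply hK hε hf x₀).aestronglyMeasurable
  · refine Eventually.of_forall fun y x _ => ?_
    calc ‖(fderiv ℝ (truncKernel K ε) (x - y)).flip (f y)‖
        ≤ ‖(fderiv ℝ (truncKernel K ε) (x - y)).flip‖ * ‖f y‖ :=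
          ContinuousLinearMap.le_opNorm _ _
      _ = ‖fderiv ℝ (truncKernel K ε) (x - y)‖ * ‖f y‖ := by
          rw [ContinuousLinearMap.opNorm_flip]
      _ ≤ C * ‖f y‖ := by
          gcongr
          exact norm_fderiv_truncKernel_le_const hK hB0 hB hε (x - y)
  · exact hfi.norm.const_mul C
  · refine Eventually.of_forall fun y x _ => ?_
    have h1 : HasFDerivAt (truncKernel K ε) (fderiv ℝ (truncKernel K ε) (x - y)) (x - y) :=
      ((hcont.differentiable one_ne_zero) _).hasFDerivAt
    have h2 : HasFDerivAt (fun x : EuclideanSpace ℝ (Fin 3) => x - y)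
        (ContinuousLinearMap.id ℝ (EuclideanSpace ℝ (Fin 3))) x :=
      (hasFDerivAt_id x).sub_const y
    have h3 := h1.comp x h2
    have h4 := h3.clm_apply (hasFDerivAt_const (f y) x)
    refine h4.congr_fderiv ?_
    ext e
    simp

/-- **The derivative of the far part is continuous** in `x` (dominated convergence: the integrand
`(∇K_ε(x − y) ·)(f y)` is continuous in `x` and bounded by `A(1 + 2B) ε⁻³ ‖f y‖ ∈ L¹`). [folklore] -/
theorem continuous_integral_fderiv_truncKernel_flip
    {K : EuclideanSpace ℝ (Fin 3) → V →L[ℝ] W} {A : ℝ} (hK : IsC1SingularKernel K A)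
    {ε : ℝ} (hε : 0 < ε) {f : EuclideanSpace ℝ (Fin 3) → V} (hf : Continuous f)
    (hfi : Integrable f) :
    Continuous fun x => ∫ y, (fderiv ℝ (truncKernel K ε) (x - y)).flip (f y) := by
  obtain ⟨B, hB0, hB⟩ := exists_norm_fderiv_radialCutoff_le
  have hDc : Continuous (fderiv ℝ (truncKernel K ε)) :=
    (contDiff_truncKernel hK hε).continuous_fderiv one_ne_zero
  refine continuous_of_dominated (bound := fun y => A * (1 + 2 * B) * (ε ^ 3)⁻¹ * ‖f y‖)
    (fun x => (continuous_fderiv_truncKernel_sub_flip_apply hK hε hf x).aestronglyMeasurable)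
    (fun x => Eventually.of_forall fun y => ?_) (hfi.norm.const_mul _)
    (Eventually.of_forall fun y => ?_)
  · calc ‖(fderiv ℝ (truncKernel K ε) (x - y)).flip (f y)‖
        ≤ ‖(fderiv ℝ (truncKernel K ε) (x - y)).flip‖ * ‖f y‖ :=
          ContinuousLinearMap.le_opNorm _ _
      _ = ‖fderiv ℝ (truncKernel K ε) (x - y)‖ * ‖f y‖ := by
          rw [ContinuousLinearMap.opNorm_flip]
      _ ≤ A * (1 + 2 * B) * (ε ^ 3)⁻¹ * ‖f y‖ := by
          gcongr
          exact norm_fderiv_truncKernel_le_const hK hB0 hB hε (x - y)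
  · have h1 : Continuous fun x : EuclideanSpace ℝ (Fin 3) =>
        (fderiv ℝ (truncKernel K ε) (x - y)).flip :=
      (ContinuousLinearMap.flipₗᵢ ℝ (EuclideanSpace ℝ (Fin 3)) V W).continuous.comp
        (hDc.comp (continuous_id.sub continuous_const))
    exact h1.clm_apply continuous_const

/-- **`C¹` regularity of the singular potential of a `C¹` density**: for a kernel of the class
`IsC1SingularKernel` (Majda–Bertozzi (4.30)–(4.31): `C¹` off the origin, `|K| ≤ A|z|⁻²`,
`|∇K| ≤ A|z|⁻³`) and a `C¹` density `f ∈ L¹` with `f` and `Df` bounded, the potential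
`v(x) = ∫ K(x − y) f(y) dy` is continuously differentiable, with
`∇v(x) = ∫ θ(z) K(z) ∘ Df(x − z) dz + ∫ (∇K₁(x − y) ·)(f y) dy` in the smooth near/far splitting
at scale `1` (Gilbarg–Trudinger §4.1, proof of Lemma 4.1; the qualitative regularity behind
Majda–Bertozzi Prop. 2.16, "Eqs. (2.90) have a smooth solution `v`").
[cite: GilbargTrudinger2001, §4.1 Lemma 4.1 (proof: regularised potentials)] -/
theorem contDiff_one_singularPotential_of_contDiff
    {K : EuclideanSpace ℝ (Fin 3) → V →L[ℝ] W} {A : ℝ} (hK : IsC1SingularKernel K A)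
    {f : EuclideanSpace ℝ (Fin 3) → V} (hf : ContDiff ℝ 1 f) (hfi : Integrable f)
    {M M' : ℝ} (hM : ∀ y, ‖f y‖ ≤ M) (hM' : ∀ y, ‖fderiv ℝ f y‖ ≤ M') :
    ContDiff ℝ 1 (singularPotential K f) := by
  have hfc : Continuous f := hf.continuous
  have hDfc : Continuous (fderiv ℝ f) := hf.continuous_fderiv one_ne_zero
  have e : singularPotential K f = fun x =>
      (∫ z, radialCutoff 1 (2 * 1) z • K z (f (x - z))) + truncPotential K 1 f x :=
    funext fun x => singularPotential_eq_near_add_truncPotential hK one_pos hfc hfi hM x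
  rw [e, contDiff_one_iff_hasFDerivAt]
  refine ⟨fun x => (∫ z, radialCutoff 1 (2 * 1) z • (K z).comp (fderiv ℝ f (x - z))) +
      ∫ y, (fderiv ℝ (truncKernel K 1) (x - y)).flip (f y), ?_, fun x => ?_⟩
  · exact (continuous_integral_radialCutoff_smul_kernel_comp hK one_pos hDfc hM').add
      (continuous_integral_fderiv_truncKernel_flip hK one_pos hfc hfi)
  · exact (hasFDerivAt_integral_radialCutoff_smul_kernel hK one_pos hf hM hM' x).add
      (hasFDerivAt_truncPotential_of_integrable hK one_pos hfc hfi x)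

/-- **The Biot–Savart velocity of a `C¹` vorticity is `C¹`**: for `ω : ℝ³ → ℝ³` of class `C¹`
with `ω ∈ L¹`, `‖ω‖ ≤ M` and `‖Dω‖ ≤ M'`, `v = K₃ ∗ ω = biotSavart ω` is continuously
differentiable (the Biot–Savart kernel is a `C¹` singular kernel,
`exists_isC1SingularKernel_biotSavartCLM`; Majda–Bertozzi Prop. 2.16: "Eqs. (2.90) have a smooth
solution `v`", here at the `C¹` level).
[cite: MajdaBertozziCUP2002, §2.4.1 Prop. 2.16 (i)–(ii) with (2.94)–(2.95), p. 71–72 (p. 63–64 of the held text)] -/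
theorem contDiff_one_biotSavart_of_contDiff
    {ω : EuclideanSpace ℝ (Fin 3) → EuclideanSpace ℝ (Fin 3)} (hω : ContDiff ℝ 1 ω)
    (hωi : Integrable ω) {M M' : ℝ} (hM : ∀ y, ‖ω y‖ ≤ M) (hM' : ∀ y, ‖fderiv ℝ ω y‖ ≤ M') :
    ContDiff ℝ 1 (biotSavart ω) := by
  obtain ⟨A, hK⟩ := exists_isC1SingularKernel_biotSavartCLM
  have h := contDiff_one_singularPotential_of_contDiff hK hω hωi hM hM'
  rwa [singularPotential_biotSavartCLM] at h

end SingularPotentialC1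

/-! ### Discharge: `curl (K₃ ∗ ω) = ω` (Majda–Bertozzi Prop. 2.16 (ii)) -/

/-- **Discharge of `curl_biotSavart`** (Majda–Bertozzi, *Vorticity and Incompressible Flow*,
§2.4.1 **Prop. 2.16 (ii)**, p. 71–72, with its proof via (2.92)–(2.97): for `div ω = 0` the
Biot–Savart velocity `v = K₃ ∗ ω` of (2.94)–(2.95) solves `curl v = ω`, `div v = 0`): for a
`C¹`, divergence-free vorticity `ω` on `ℝ³` with `ω, Dω` integrable and bounded,
`curl (biotSavart ω) = ω` everywhere. Proof as assembled from the tree: `ω` is weakly divergence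
free (`VectorCalculus.IsDivFree.isWeaklyDivFree_holds`), `K₃ ∗ ω` is `C¹`
(`contDiff_one_biotSavart_of_contDiff`, this file), and for continuous weakly divergence-free
`ω ∈ L¹ ∩ L^∞` with `K₃ ∗ ω ∈ C¹` the tree's `curl_biotSavart_eq_of_isWeaklyDivFree`
(`BiotSavartHolderCurl.lean`: the weak form of `−curl curl ψ + ∇ div ψ = Δψ`, (2.97), through
the Newtonian potential (2.92)–(2.93), then du Bois-Reymond) gives the pointwise identity. The
integrability of `Dω` assumed by the fact is not used. (The book prints
`K₃(x)h = x × h/(4π|x|³)` in (2.95); the tree's `biotSavartKernel x h = (4π|x|³)⁻¹ h × x` is the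
sign for which `v = −curl ψ`, `Δψ = ω`, i.e. the convention of (2.92)–(2.94); see the design
notes of `Vorticity.lean`.)
[cite: MajdaBertozziCUP2002, §2.4.1 Prop. 2.16 (ii) and its proof, eqs. (2.90)–(2.97), p. 71–72 (p. 63–64 of the held text)] -/
theorem curl_biotSavart_holds : curl_biotSavart := by
  intro ω hω hdiv hint _hint' hbdd
  obtain ⟨C, hC⟩ := hbdd
  exact curl_biotSavart_eq_of_isWeaklyDivFree hω.continuous hint (fun y => (hC y).1)
    (VectorCalculus.IsDivFree.isWeaklyDivFree_holds hdiv hω)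
    (contDiff_one_biotSavart_of_contDiff hω hint (fun y => (hC y).1) fun y => (hC y).2)

end Literature.Analysis.FluidPDE
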